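import Literature.NumberTheory.LFunctions.LagariasDifferencedXiSpacings
import Mathlib.NumberTheory.LSeries.Dirichlet
import HarnessLib

/-!
# Proofs for Lagarias 2005, §4: Lemma 4.1 (1)

LABEL (line 1): RH-FREE discharge of the named fact `lagarias2005_lemma_4_1_1` of
`LagariasDifferencedXiSpacings.lean`. bears_on: LADDER-RH B-C/B-P (COLUMN 6 DBR). WHAT THIS IS
NOT: an unconditional bound for `ζ′/ζ` in the half-plane of absolute convergence; nothing here
bears on the truth of RH.

Source: J. C. Lagarias, *Zero spacing distributions for differenced L-functions*, Acta Arith. 120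
(2005) 159–184 = arXiv:math/0601653 [Lagarias2005], **Lemma 4.1 (1)** (arXiv p.8): "`R_h(T) = O(1)`
for `h > ½` … follows from logarithmic differentiation of the Euler product for `ζ(s)`, noting that
`h > ½` is the region of absolute convergence." Followed literally: for `σ = ½ + h > 1`,
`−ζ′/ζ(σ + it) = Σ Λ(n) n^{−σ−it}` (Mathlib
`ArithmeticFunction.LSeries_vonMangoldt_eq_deriv_riemannZeta_div`), so
`|ζ′/ζ(σ+it)| ≤ Σ Λ(n) n^{−σ} =: C(h)` for every `t`, and the supremum `R_h(T)` over
`t ∈ [T, T+1]` is `≤ C(h)` for every `T`.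

Division of labour in the cell (rh-crit/dbl): the discharge of `lagarias2005_lemma_6_1_ii`
(= Lemma 2.1 (2) under `s = ½ − iz`, `lagarias2005_lemma_6_1_ii_iff`) rides with the §2 proofs
(`LagariasDifferencedXiProofs.lean`), where Lemma 2.1 (2) is proved.

## Main result
* `lagarias2005_lemma_4_1_1_holds : lagarias2005_lemma_4_1_1`.

## References
* [Lagarias2005] J. C. Lagarias, Acta Arith. 120 (2005) 159–184 = arXiv:math/0601653, Lemma 4.1.
-/

noncomputable section

open Complex Set
open scoped LSeries.notation

namespace Literature.NumberTheory.LFunctions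

open ArithmeticFunction in
/-- **Lagarias 2005, Lemma 4.1 (1)** (discharge of `lagarias2005_lemma_4_1_1`): for `h > ½`,
`R_h(T) ≤ Σ_n Λ(n) n^{−(½+h)}` for every `T` — logarithmic differentiation of the Euler product
in its region of absolute convergence. [cite: Lagarias2005, Lemma 4.1 (1) p.8] -/
theorem lagarias2005_lemma_4_1_1_holds : lagarias2005_lemma_4_1_1 := by
  intro h hh
  set σ : ℝ := 1 / 2 + h with hσ
  refine ⟨∑' n, ‖LSeries.term ↗Λ (σ : ℂ) n‖, fun T ↦ ?_⟩
  apply csSup_le ((nonempty_Icc.2 (by linarith)).image _)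
  rintro _ ⟨t, -, rfl⟩
  have hs : 1 < ((1 : ℂ) / 2 + h + t * I).re := by simp; linarith
  have key := LSeries_vonMangoldt_eq_deriv_riemannZeta_div hs
  have e : deriv riemannZeta (1 / 2 + h + t * I) / riemannZeta (1 / 2 + h + t * I) =
      -L ↗Λ (1 / 2 + h + t * I) := by
    rw [key]; ring
  show ‖_‖ ≤ _
  rw [e, norm_neg]
  have hsum : LSeriesSummable ↗Λ (1 / 2 + h + t * I) := LSeriesSummable_vonMangoldt hs
  calc ‖L ↗Λ (1 / 2 + h + t * I)‖
      ≤ ∑' n, ‖LSeries.term ↗Λ (1 / 2 + h + t * I) n‖ := norm_tsum_le_tsum_norm hsum.norm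
    _ = ∑' n, ‖LSeries.term ↗Λ (σ : ℂ) n‖ := by
        congr 1
        funext n
        rw [LSeries.norm_term_eq, LSeries.norm_term_eq]
        simp [hσ]

end Literature.NumberTheory.LFunctions
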